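import Literature.NumberTheory.LFunctions.BCHCrossMainNondiv
import Literature.NumberTheory.LFunctions.BCHHyperbolaWedgeCount
import HarnessLib

/-!
# The cross term of the BCH mean square: the main sum of one pair `(h, k)`

Topic `Literature/NumberTheory/LFunctions`. Everything in this file is PROVED (no definitions, no
named facts).

For a pair `(h, k)` with `g = (h,k)`, `h = gh'`, `k = gk'`, the exponential sum
`S_{hk} = Σ_{μ ≤ X} Σ_{ν ∈ crossNuSet(μ)} e^{-ic}` of `BCH.mainSum_eq` splits according to `k' ∣ μ`:

* `BCH.crossNuSet_mul_eq_wedgeNu` — for `μ = k'ρ` the switched-on `ν` are `wedgeNu(ρ)` and the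
  phase is `1` (`c = 2πh'ρν`), `BCH.cexp_crossFreq_mul_eq_one`;
* `BCH.sum_div_eq_wedgeCount` — `Σ_{μ ≤ X, k' ∣ μ} Σ_{ν ∈ crossNuSet(μ)} e^{-ic} = Σ_{ρ ≤ X} #wedgeNu(ρ)`;
* `BCH.crossNuSet_eq_empty_of_lt` — if `h < k` nothing is switched on;
* `BCH.norm_pairSum_sub_main_le` — **the pair sum**: for `0 < T ≤ T' ≤ 2T`, `X = ⌊√(T'/2π)⌋`,
  `h, k ≤ N`, `2N ≤ √(T'/2π)`:
  `|S_{hk} − [k ≤ h] (T'−T)/(2πh') log(h'/k')|`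
  `  ≤ 2η(T'−T)/(2πh') + 7(T'−T)/√(2πT) + 2√(T'/2π) + 2 + (X/k' + 1) k' (1 + log k')`.

## References

* [Titchmarsh1986] E. C. Titchmarsh, *The Theory of the Riemann Zeta-Function*, 2nd ed. (1986), §9.22.
-/

noncomputable section

open Finset Real Complex

namespace Literature.NumberTheory.LFunctions.BCH

/-! ### Reduced pair bookkeeping -/

/-- `h = g h'`, `k = g k'` as reals, with `g = (h,k) > 0` for `k > 0`. [folklore] -/
theorem cast_eq_gcd_mul (h k : ℕ) :
    (h : ℝ) = (Nat.gcd h k : ℝ) * ((h / Nat.gcd h k : ℕ) : ℝ) ∧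
      (k : ℝ) = (Nat.gcd h k : ℝ) * ((k / Nat.gcd h k : ℕ) : ℝ) := by
  constructor
  · exact_mod_cast (Nat.mul_div_cancel' (Nat.gcd_dvd_left h k)).symm
  · exact_mod_cast (Nat.mul_div_cancel' (Nat.gcd_dvd_right h k)).symm

/-- `c = 2πh'ρν` for `μ = k'ρ`. [folklore] -/
theorem crossFreq_mul_eq {h k : ℕ} (hk : 0 < k) (ρ ν : ℕ) :
    crossFreq h k (k / Nat.gcd h k * ρ) ν = 2 * π * ((h / Nat.gcd h k : ℕ) : ℝ) * ρ * ν := by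
  have hg : (0 : ℝ) < Nat.gcd h k := by exact_mod_cast Nat.gcd_pos_of_pos_right h hk
  have hkR : (0 : ℝ) < k := by exact_mod_cast hk
  rw [crossFreq_def, Nat.cast_mul, Nat.cast_div_charZero (Nat.gcd_dvd_right h k),
    Nat.cast_div_charZero (Nat.gcd_dvd_left h k)]
  field_simp

/-- The phase of a quadruple with `k' ∣ μ` is trivial: `e^{-ic} = 1`. [folklore] -/
theorem cexp_crossFreq_mul_eq_one {h k : ℕ} (hk : 0 < k) (ρ ν : ℕ) :
    cexp (-I * crossFreq h k (k / Nat.gcd h k * ρ) ν) = 1 := by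
  rw [crossFreq_mul_eq hk]
  have : -I * ((2 * π * ((h / Nat.gcd h k : ℕ) : ℝ) * ρ * ν : ℝ) : ℂ) =
      (((-((h / Nat.gcd h k * ρ * ν : ℕ) : ℤ) : ℤ)) : ℂ) * (2 * π * I) := by
    simp only [Int.cast_neg, Nat.cast_mul, Int.cast_mul, Int.cast_natCast, Complex.ofReal_mul,
      Complex.ofReal_natCast, Complex.ofReal_ofNat]
    ring
  rw [this, Complex.exp_int_mul_two_pi_mul_I]

/-- **For `μ = k'ρ` the switched-on `ν` are `wedgeNu(ρ)`.** [folklore] -/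
theorem crossNuSet_mul_eq_wedgeNu (T T' : ℝ) (X : ℕ) {h k : ℕ} (hh : 0 < h) (hk : 0 < k) (ρ : ℕ) :
    crossNuSet T T' X h k (k / Nat.gcd h k * ρ) =
      wedgeNu T T' X (h / Nat.gcd h k) (k / Nat.gcd h k) ρ := by
  set g := Nat.gcd h k with hg
  set h' := h / g with hh'
  set k' := k / g with hk'
  have hg0 : 0 < g := Nat.gcd_pos_of_pos_right h hk
  have eh : h = g * h' := (Nat.mul_div_cancel' (Nat.gcd_dvd_left h k)).symm
  have ek : k = g * k' := (Nat.mul_div_cancel' (Nat.gcd_dvd_right h k)).symm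
  have hh'0 : 0 < h' := Nat.div_pos (Nat.le_of_dvd hh (Nat.gcd_dvd_left h k)) hg0
  have hk'0 : 0 < k' := Nat.div_pos (Nat.le_of_dvd hk (Nat.gcd_dvd_right h k)) hg0
  have hh'R : (0 : ℝ) < h' := by exact_mod_cast hh'0
  have hπ := Real.pi_pos
  ext ν
  rw [mem_crossNuSet, mem_wedgeNu, crossFreq_mul_eq hk]
  rw [← hg, ← hh']
  have e1 : T ≤ 2 * π * (h' : ℝ) * ρ * ν ↔ T / (2 * π * h') ≤ (ρ : ℝ) * ν := by
    rw [div_le_iff₀ (by positivity)]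
    constructor <;> intro H <;> nlinarith [H]
  have e2 : 2 * π * (h' : ℝ) * ρ * ν ≤ T' ↔ (ρ : ℝ) * ν ≤ T' / (2 * π * h') := by
    rw [le_div_iff₀ (by positivity)]
    constructor <;> intro H <;> nlinarith [H]
  have e3 : k' * ρ * k ≤ ν * h ↔ ρ * k' ^ 2 ≤ ν * h' := by
    rw [eh, ek]
    constructor
    · intro H
      have : g * (ρ * k' ^ 2) ≤ g * (ν * h') := by nlinarith [H]
      exact Nat.le_of_mul_le_mul_left this hg0
    · intro H; nlinarith [H]
  have e4 : ν * k ≤ k' * ρ * h ↔ ν ≤ ρ * h' := by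
    rw [eh, ek]
    constructor
    · intro H
      have : (g * k') * ν ≤ (g * k') * (ρ * h') := by nlinarith [H]
      exact Nat.le_of_mul_le_mul_left this (Nat.mul_pos hg0 hk'0)
    · intro H; nlinarith [H]
  rw [e1, e2, e3, e4]

/-- If `h < k` nothing is switched on (`μk ≤ νh < νk` and `νk ≤ μh < μk` are incompatible).
[folklore] -/
theorem crossNuSet_eq_empty_of_lt (T T' : ℝ) (X : ℕ) {h k μ : ℕ} (hhk : h < k) (hμ : 0 < μ) :
    crossNuSet T T' X h k μ = ∅ := by
  rw [Finset.eq_empty_iff_forall_notMem]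
  intro ν hν
  rw [mem_crossNuSet, Finset.mem_Icc] at hν
  obtain ⟨⟨hν1, -⟩, -, -, h1, h2⟩ := hν
  have a1 : μ * h < μ * k := Nat.mul_lt_mul_of_pos_left hhk hμ
  have a2 : ν * h < ν * k := Nat.mul_lt_mul_of_pos_left hhk hν1
  -- `μk ≤ νh < νk` gives `μ < ν`; `νk ≤ μh < μk` gives `ν < μ`
  have b1 : μ * k < ν * k := lt_of_le_of_lt h1 a2
  have b2 : ν * k < μ * k := lt_of_le_of_lt h2 a1
  omega

/-- **The `k' ∣ μ` part is the wedge count**: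
`Σ_{μ ≤ X, k' ∣ μ} Σ_{ν ∈ crossNuSet(μ)} e^{-ic} = Σ_{ρ ≤ X} #wedgeNu(ρ)` (`X = ⌊√(T'/2π)⌋`; the
terms `k'ρ > X` vanish). [cite: Titchmarsh1986, §9.22] -/
theorem sum_div_eq_wedgeCount (T : ℝ) {T' : ℝ} (hT' : 0 < T') {h k : ℕ} (hh : 0 < h) (hk : 0 < k) :
    ∑ μ ∈ (Finset.Icc 1 ⌊Real.sqrt (T' / (2 * π))⌋₊).filter (fun μ => (k / Nat.gcd h k) ∣ μ),
        ∑ ν ∈ crossNuSet T T' ⌊Real.sqrt (T' / (2 * π))⌋₊ h k μ, cexp (-I * crossFreq h k μ ν) =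
      ((∑ ρ ∈ Finset.Icc 1 ⌊Real.sqrt (T' / (2 * π))⌋₊,
        ((wedgeNu T T' ⌊Real.sqrt (T' / (2 * π))⌋₊ (h / Nat.gcd h k) (k / Nat.gcd h k) ρ).card : ℝ) : ℝ) : ℂ) := by
  set X := ⌊Real.sqrt (T' / (2 * π))⌋₊ with hX
  set k' := k / Nat.gcd h k with hk'
  set h' := h / Nat.gcd h k with hh'
  have hg0 : 0 < Nat.gcd h k := Nat.gcd_pos_of_pos_right h hk
  have hk'0 : 0 < k' := Nat.div_pos (Nat.le_of_dvd hk (Nat.gcd_dvd_right h k)) hg0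
  have hh'0 : 0 < h' := Nat.div_pos (Nat.le_of_dvd hh (Nat.gcd_dvd_left h k)) hg0
  have hπ := Real.pi_pos
  -- reindex `μ = k'ρ`, `ρ ∈ [1, X/k']`
  have himage : (Finset.Icc 1 X).filter (fun μ => k' ∣ μ) = (Finset.Icc 1 (X / k')).image (fun ρ => k' * ρ) := by
    ext μ
    simp only [Finset.mem_filter, Finset.mem_Icc, Finset.mem_image]
    constructor
    · rintro ⟨⟨h1, h2⟩, ρ, rfl⟩
      refine ⟨ρ, ⟨?_, ?_⟩, rfl⟩
      · rcases Nat.eq_zero_or_pos ρ with rfl | hρ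
        · simp at h1
        · exact hρ
      · exact (Nat.le_div_iff_mul_le hk'0).2 (by rw [mul_comm]; exact h2)
    · rintro ⟨ρ, ⟨h1, h2⟩, rfl⟩
      refine ⟨⟨Nat.mul_pos hk'0 h1, ?_⟩, dvd_mul_right _ _⟩
      have := (Nat.le_div_iff_mul_le hk'0).1 h2
      rw [mul_comm]; exact this
  rw [himage, Finset.sum_image (fun ρ _ ρ' _ hρρ' => Nat.eq_of_mul_eq_mul_left hk'0 hρρ')]
  -- each term: `Σ_{ν ∈ wedgeNu ρ} 1 = #wedgeNu ρ`
  have hterm : ∀ ρ : ℕ, ∑ ν ∈ crossNuSet T T' X h k (k' * ρ), cexp (-I * crossFreq h k (k' * ρ) ν) =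
      ((wedgeNu T T' X h' k' ρ).card : ℂ) := by
    intro ρ
    rw [Finset.sum_congr rfl (fun ν _ => cexp_crossFreq_mul_eq_one hk ρ ν), Finset.sum_const,
      nsmul_eq_mul, mul_one, crossNuSet_mul_eq_wedgeNu T T' X hh hk ρ]
  simp_rw [hterm]
  -- extend the `ρ`-range from `[1, X/k']` to `[1, X]`: the extra terms vanish
  push_cast
  refine Finset.sum_subset (Finset.Icc_subset_Icc_right (Nat.div_le_self X k')) ?_
  intro ρ hρ hρ'
  rw [Finset.mem_Icc] at hρ hρ'
  have hbig : X / k' < ρ := by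
    by_contra hle; push Not at hle; exact hρ' ⟨hρ.1, hle⟩
  -- `k'ρ ≥ X + 1 > √(T'/2π)`, so `2πk'²ρ² > T'`
  have h1 : X + 1 ≤ k' * ρ := by
    have := Nat.lt_div_mul_add (a := X) hk'0
    have h2 : X / k' * k' + k' ≤ ρ * k' := by nlinarith
    rw [mul_comm k' ρ]; omega
  have hV : Real.sqrt (T' / (2 * π)) < (k' : ℝ) * ρ := by
    have a := Nat.lt_floor_add_one (Real.sqrt (T' / (2 * π)))
    rw [← hX] at a
    have b : ((X + 1 : ℕ) : ℝ) ≤ ((k' * ρ : ℕ) : ℝ) := by exact_mod_cast h1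
    push_cast at b
    linarith
  have hout : T' < 2 * π * (k' : ℝ) ^ 2 * (ρ : ℝ) ^ 2 := by
    have hsq : T' / (2 * π) < ((k' : ℝ) * ρ) ^ 2 := by
      rw [← Real.sqrt_lt_sqrt_iff (by positivity), Real.sqrt_sq (by positivity)]
      · exact hV
    rw [div_lt_iff₀ (by positivity)] at hsq
    nlinarith [hsq]
  rw [wedgeNu_eq_empty hh'0 (Or.inr hout)]
  simp

/-- **The main exponential sum of one pair.** For `0 < T ≤ T' ≤ 2T`, `X = ⌊√(T'/2π)⌋`,
`1 ≤ h, k ≤ N`, `2N ≤ √(T'/2π)`, `h' = h/(h,k)`, `k' = k/(h,k)`, `η = (T'−T)/T`: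
`|Σ_{μ ≤ X} Σ_{ν ∈ crossNuSet(μ)} e^{-ic} − [k ≤ h] (T'−T)/(2πh') log(h'/k')|`
`  ≤ 2η(T'−T)/(2πh') + 7(T'−T)/√(2πT) + 2√(T'/2π) + 2 + (X/k' + 1) k' (1 + log k')`.
[cite: Titchmarsh1986, §9.22] -/
theorem norm_pairSum_sub_main_le {T T' : ℝ} (hT : 0 < T) (hTT' : T ≤ T') (hT'2 : T' ≤ 2 * T)
    {h k N : ℕ} (hh : 0 < h) (hk : 0 < k) (hhN : h ≤ N)
    (hN : 2 * (N : ℝ) ≤ Real.sqrt (T' / (2 * π))) :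
    ‖∑ μ ∈ Finset.Icc 1 ⌊Real.sqrt (T' / (2 * π))⌋₊,
        ∑ ν ∈ crossNuSet T T' ⌊Real.sqrt (T' / (2 * π))⌋₊ h k μ, cexp (-I * crossFreq h k μ ν) -
      (if k ≤ h then (((T' - T) / (2 * π * ((h / Nat.gcd h k : ℕ) : ℝ)) *
        Real.log (((h / Nat.gcd h k : ℕ) : ℝ) / ((k / Nat.gcd h k : ℕ) : ℝ)) : ℝ) : ℂ) else 0)‖ ≤
      2 * ((T' - T) / T) * ((T' - T) / (2 * π * ((h / Nat.gcd h k : ℕ) : ℝ))) +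
        7 * ((T' - T) / Real.sqrt (2 * π * T)) + 2 * Real.sqrt (T' / (2 * π)) + 2 +
        (((⌊Real.sqrt (T' / (2 * π))⌋₊ / (k / Nat.gcd h k) : ℕ) : ℝ) + 1) *
          (((k / Nat.gcd h k : ℕ) : ℝ) * (1 + Real.log ((k / Nat.gcd h k : ℕ) : ℝ))) := by
  set X := ⌊Real.sqrt (T' / (2 * π))⌋₊ with hX
  set k' := k / Nat.gcd h k with hk'
  set h' := h / Nat.gcd h k with hh'
  have hT' : 0 < T' := by linarith
  have hπ := Real.pi_pos
  have hg0 : 0 < Nat.gcd h k := Nat.gcd_pos_of_pos_right h hk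
  have hk'0 : 0 < k' := Nat.div_pos (Nat.le_of_dvd hk (Nat.gcd_dvd_right h k)) hg0
  have hh'0 : 0 < h' := Nat.div_pos (Nat.le_of_dvd hh (Nat.gcd_dvd_left h k)) hg0
  have hh'R : (0 : ℝ) < h' := by exact_mod_cast hh'0
  have hk'R : (0 : ℝ) < k' := by exact_mod_cast hk'0
  have hlogk' : 0 ≤ Real.log (k' : ℝ) := Real.log_natCast_nonneg k'
  -- the right-hand side is non-negative
  have hR0 : 0 ≤ 2 * ((T' - T) / T) * ((T' - T) / (2 * π * (h' : ℝ))) +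
      7 * ((T' - T) / Real.sqrt (2 * π * T)) + 2 * Real.sqrt (T' / (2 * π)) + 2 +
      (((X / k' : ℕ) : ℝ) + 1) * ((k' : ℝ) * (1 + Real.log (k' : ℝ))) := by
    have : 0 ≤ T' - T := by linarith
    positivity
  rcases lt_or_ge h k with hhk | hkh
  · -- `h < k`: everything vanishes
    rw [if_neg (not_le.2 hhk)]
    have h0 : ∑ μ ∈ Finset.Icc 1 X, ∑ ν ∈ crossNuSet T T' X h k μ, cexp (-I * crossFreq h k μ ν) = 0 := by
      refine Finset.sum_eq_zero fun μ hμ => ?_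
      rw [crossNuSet_eq_empty_of_lt T T' X hhk (Finset.mem_Icc.1 hμ).1, Finset.sum_empty]
    rw [h0, sub_zero, norm_zero]
    exact hR0
  · -- `k ≤ h`: split `μ` by `k' ∣ μ`
    rw [if_pos hkh]
    have hk'h' : k' ≤ h' := Nat.div_le_div_right hkh
    have hP : 2 * (h' : ℝ) ≤ Real.sqrt (T' / (2 * π)) := by
      have : (h' : ℝ) ≤ h := by exact_mod_cast Nat.div_le_self h (Nat.gcd h k)
      have : (h : ℝ) ≤ N := by exact_mod_cast hhN
      linarith
    rw [← Finset.sum_filter_add_sum_filter_not (Finset.Icc 1 X) (fun μ => k' ∣ μ)]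
    have hdiv := sum_div_eq_wedgeCount T hT' hh hk
    rw [← hX, ← hk', ← hh'] at hdiv
    rw [hdiv]
    have hW := abs_wedgeCount_sub_main_le hT hTT' hT'2 hk'0 hk'h' hP
    rw [← hX] at hW
    have hND := norm_nondivSum_le T T' X (h := h) hk
    rw [← hk'] at hND
    calc ‖((∑ ρ ∈ Finset.Icc 1 X, ((wedgeNu T T' X h' k' ρ).card : ℝ) : ℝ) : ℂ) +
          ∑ μ ∈ (Finset.Icc 1 X).filter (fun μ => ¬ k' ∣ μ),
            ∑ ν ∈ crossNuSet T T' X h k μ, cexp (-I * crossFreq h k μ ν) -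
          (((T' - T) / (2 * π * (h' : ℝ)) * Real.log ((h' : ℝ) / k') : ℝ) : ℂ)‖
        = ‖(((∑ ρ ∈ Finset.Icc 1 X, ((wedgeNu T T' X h' k' ρ).card : ℝ)) -
            (T' - T) / (2 * π * (h' : ℝ)) * Real.log ((h' : ℝ) / k') : ℝ) : ℂ) +
          ∑ μ ∈ (Finset.Icc 1 X).filter (fun μ => ¬ k' ∣ μ),
            ∑ ν ∈ crossNuSet T T' X h k μ, cexp (-I * crossFreq h k μ ν)‖ := by
          congr 1; push_cast; ring
      _ ≤ |(∑ ρ ∈ Finset.Icc 1 X, ((wedgeNu T T' X h' k' ρ).card : ℝ)) -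
            (T' - T) / (2 * π * (h' : ℝ)) * Real.log ((h' : ℝ) / k')| +
          ‖∑ μ ∈ (Finset.Icc 1 X).filter (fun μ => ¬ k' ∣ μ),
            ∑ ν ∈ crossNuSet T T' X h k μ, cexp (-I * crossFreq h k μ ν)‖ := by
          refine (norm_add_le _ _).trans ?_
          rw [Complex.norm_real, Real.norm_eq_abs]
      _ ≤ _ := by linarith

end Literature.NumberTheory.LFunctions.BCH
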